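import Literature.Analysis.InnerProduct.EquilateralTriangleHeatTraceExpansion
import HarnessLib

/-!
# The NEUMANN equilateral triangle: spectrum `{(16π²/(9ℓ²))(m² + mn + n²) : m, n ≥ 0}` (Lamé; McCartin; Rudnick–Wigman §2.1),
# `Z_N = Z_D + θ` (the closed Weyl chamber = the open one, two walls and the origin), hence
# `Z_N(t) = |T|/(4πt) + |∂T|/(8√(πt)) + 1/3 + O(t^∞)` — the boundary sign flips, Kac's corner term `1/3` stays; one zero mode,
# `ζ_N(0) = 1/3 − 1 = −2/3`; Neumann-vs-Dirichlet and Neumann-triangle-vs-Neumann-rectangle are audible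

Layer `Literature/Analysis/InnerProduct`, namespace `Literature.Analysis.InnerProduct`; sequel to row g39-#10
(`EquilateralTriangleHeatTraceExpansion.lean`, IMPORTED: `summable_exp_neg_mul_equilateralTriangle`,
`isBigO_equilateralTriangle_heatTrace_sub`, `tendsto_equilateralTriangle_cofinite_atTop`, `isBigO_equilateralTriangle_heatTrace_expansion`),
using the Dirichlet and Neumann intervals / rectangles of row g38-#2 (`summable_exp_neg_mul_dirichletInterval`,
`tsum_exp_neg_mul_dirichletInterval_eq`, `summable_exp_neg_mul_neumannInterval`, `tsum_exp_neg_mul_neumannInterval_eq`,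
`tendsto_neumannInterval_cofinite_atTop`, `summable_exp_neg_mul_neumannRectangle`, `isBigO_neumannRectangle_heatTrace_expansion`,
the scaled circle `isBigO_tsum_exp_neg_mul_mul_intCast_sq_sub`) and the abstract continuation / inverse results of rows
g37-#1/#3/#6/#10. Lane `lit-hodgefound` (Track 2 foundations library), prover seat `lit-hodgefound-p06` (generation 39),
self-proposed row g39-#12. THEOREMS ONLY (no definition, no instance, no notation, no named fact).

## Sources, verbatim

Z. Rudnick, I. Wigman, *On the Robin spectrum for the equilateral triangle*, J. Phys. A 55 (2022) (arXiv:2201.01117), §2.1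
"Neumann eigenfunctions" (chunk p0005): "The eigenfunctions are either symmetric or antisymmetric w.r.t the altitude of the
triangle … A complete set of orthogonal Neumann eigenfunctions is `T^{s/a}_{m,n}(x,y) = …` where for the symmetric eigenfunctions
`T^s_{m,n}` we take `0 ≤ m ≤ n` and cosine, and for the antisymmetric ones `T^a_{m,n}` we take `0 ≤ m < n` and sine. Here the
`m,n ≥ 0` are integers, and `m,n,ℓ` satisfy `m+n+ℓ = 0` with the corresponding eigenvalue being `Λ_{m,n}(0) := (2π²/(27r²))(m²+n²+ℓ²)
= (4π²/(27r²))(m²+mn+n²)`." (`r` the inradius: `27r² = 9a²/4` for side `a`); §1: "The equilateral triangle is one of the few planar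
domains where the Dirichlet and Neumann eigenvalue problems were explicitly determined, by Lamé in 1833". P. Bérard, B. Helffer
(2016), §3–§4 (the torus `(16π²/9)(m²+mn+n²)`, `m,n ∈ ℤ`, and Proposition 4.1). H. P. McKean, I. M. Singer (1967), eq. (4a) (Kac's
polygon formula) and eq. (6) ("`(4πt)^{d/2}Z± = the volume of D ± (√(πt)/2) × the surface area of B + ⋯`", the sign of the
boundary term for `Δ±`). P. B. Gilkey (1995), §1.10 Lemma 1.10.1. P. H. Bérard (1986), Ch. VII.

## The computation

`c = 16π²/(9ℓ²)`, `Q(m,n) = m² + mn + n²`; `{(m,n) : 0 ≤ m ≤ n} ⊔ {(m,n) : 0 ≤ m < n}` is, after swapping the second piece, all of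
`ℕ × ℕ`, and `Q` is symmetric: the Neumann spectrum is the family `(j,k) ↦ cQ(j,k)` on `ℕ × ℕ` (the closed Weyl chamber).
`ℕ² = {j,k ≥ 1} ⊔ {j ≥ 1, k = 0} ⊔ {j = 0}`: `Z_N = Z_D + ∑_{j≥1}e^{−tcj²} + ∑_{k≥0}e^{−tck²} = Z_D + (θ−1)/2 + (θ+1)/2 = Z_D + θ`,
`θ(t) = ∑_{a∈ℤ}e^{−tca²} = (π/c)^{1/2}t^{−1/2} + O(t^∞) = (3ℓ/(4√π))t^{−1/2} + O(t^∞)`. Hence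
`Z_N = |T|/(4πt) + 3ℓ/(8√(πt)) + 1/3 + O(t^∞)`: the perimeter term changes sign, the corner term `1/3` does not; one zero mode.

## What is proved

* §1 **`summable_exp_neg_mul_neumannEquilateralTriangle`**, **`tsum_exp_neg_mul_neumannEquilateralTriangle`** (`Z_N = Z_D + θ`),
  **`isBigO_neumannEquilateralTriangle_heatTrace_sub`** (`Z_N − ((√3/4)ℓ²/(4π)t^{−1} + 3ℓ/(8√π)t^{−1/2} + 1/3) = O(t^β)` ∀β),
  `isBigO_neumannEquilateralTriangle_heatTrace_expansion`, `tendsto_neumannEquilateralTriangle_cofinite_atTop`,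
  **`ncard_setOf_neumannEquilateralTriangle_eq_zero`** (`= 1`).
* §2 **`tendsto_ncard_neumannEquilateralTriangle_le_div`** (WEYL), **`Gamma_mul_tsum_neumannEquilateralTriangle_cpow_neg_eq`** (`−1/s`),
  **`tendsto_neumannEquilateralTriangleZeta_continuation_nhdsNE_zero`** (`ζ_N(0) = −2/3`),
  `tendsto_sub_one_mul_neumannEquilateralTriangleZeta_continuation`.
* §3 **`isBigO_neumann_sub_dirichlet_equilateralTriangle`** (`Z_N − Z_D − (3ℓ/(4√π))t^{−1/2} = O(t^β)`),
  **`not_isospectral_neumann_dirichlet_equilateralTriangle`**, **`not_isospectral_neumannEquilateralTriangle_neumannRectangle`**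
  (`1/3 ≠ ¼`).

## References

* [RudnickWigman2022] Z. Rudnick, I. Wigman, *On the Robin spectrum for the equilateral triangle*, J. Phys. A 55 (2022) 254004,
  doi:10.1088/1751-8121/ac6f9b, §2.1.
* [BerardHelffer2016] P. Bérard, B. Helffer, Lett. Math. Phys. 106 (2016) 1729–1789, §3, §4.1.
* [McKeanSinger1967] H. P. McKean, I. M. Singer, J. Differential Geom. 1 (1967) 43–69, eq. (4a), (6).
* [Kac1966] M. Kac, Amer. Math. Monthly 73 (1966) 1–23, §13–§15.
* [Gilkey1995] P. B. Gilkey, *Invariance theory, the heat equation, and the Atiyah–Singer index theorem*, 2nd ed. (1995), §1.10.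
* [Berard1986] P. H. Bérard, *Spectral Geometry: Direct and Inverse Problems*, LNM 1207 (1986), Ch. VII.
-/

noncomputable section

open Real Filter Topology Set Asymptotics

namespace Literature.Analysis.InnerProduct

/-! ### §0 `ℕ × ℕ = {j ≥ 1} ⊔ {j = 0}` in either coordinate -/

/-- `ℕ × ℕ = {(j+1, k)} ⊔ {(0, k)}`. [folklore] -/
private theorem hasSum_nat_prod_succ_fst {G : ℕ × ℕ → ℝ} {p z : ℝ} (hp : HasSum (fun q : ℕ × ℕ ↦ G (q.1 + 1, q.2)) p)
    (hz : HasSum (fun k : ℕ ↦ G (0, k)) z) : HasSum G (p + z) := by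
  have hbij : Function.Bijective (Sum.elim (fun q : ℕ × ℕ ↦ (q.1 + 1, q.2)) (fun k : ℕ ↦ ((0 : ℕ), k))) := by
    refine ⟨?_, ?_⟩
    · rintro (⟨r, s⟩ | k) (⟨r', s'⟩ | k') h <;>
        simp only [Sum.elim_inl, Sum.elim_inr, Sum.inl.injEq, Sum.inr.injEq, Prod.mk.injEq, reduceCtorEq, true_and,
          false_and] at h ⊢ <;>
        omega
    · rintro ⟨x, y⟩
      rcases Nat.eq_zero_or_pos x with rfl | hx
      · exact ⟨Sum.inr y, rfl⟩
      · refine ⟨Sum.inl (x - 1, y), ?_⟩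
        show (x - 1 + 1, y) = (x, y)
        rw [Nat.sub_add_cancel hx]
  exact (Equiv.ofBijective _ hbij).hasSum_iff.mp
    (HasSum.sum (f := G ∘ Sum.elim (fun q : ℕ × ℕ ↦ (q.1 + 1, q.2)) (fun k : ℕ ↦ ((0 : ℕ), k))) hp hz)

/-- `ℕ × ℕ = {(j, k+1)} ⊔ {(j, 0)}`. [folklore] -/
private theorem hasSum_nat_prod_succ_snd {G : ℕ × ℕ → ℝ} {p z : ℝ} (hp : HasSum (fun q : ℕ × ℕ ↦ G (q.1, q.2 + 1)) p)
    (hz : HasSum (fun j : ℕ ↦ G (j, 0)) z) : HasSum G (p + z) := by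
  have hbij : Function.Bijective (Sum.elim (fun q : ℕ × ℕ ↦ (q.1, q.2 + 1)) (fun j : ℕ ↦ (j, (0 : ℕ)))) := by
    refine ⟨?_, ?_⟩
    · rintro (⟨r, s⟩ | j) (⟨r', s'⟩ | j') h <;>
        simp only [Sum.elim_inl, Sum.elim_inr, Sum.inl.injEq, Sum.inr.injEq, Prod.mk.injEq, reduceCtorEq, and_true,
          and_false] at h ⊢ <;>
        omega
    · rintro ⟨x, y⟩
      rcases Nat.eq_zero_or_pos y with rfl | hy
      · exact ⟨Sum.inr x, rfl⟩
      · refine ⟨Sum.inl (x, y - 1), ?_⟩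
        show (x, y - 1 + 1) = (x, y)
        rw [Nat.sub_add_cancel hy]
  exact (Equiv.ofBijective _ hbij).hasSum_iff.mp
    (HasSum.sum (f := G ∘ Sum.elim (fun q : ℕ × ℕ ↦ (q.1, q.2 + 1)) (fun j : ℕ ↦ (j, (0 : ℕ)))) hp hz)

/-- `π/(3ℓ/4) = 4π/(3ℓ)`. [folklore] -/
private theorem pi_div_three_mul_div_four_n {ℓ : ℝ} (hℓ : 0 < ℓ) : π / (3 * ℓ / 4) = 4 * π / (3 * ℓ) := by
  field_simp

/-- `(π/(π/a)²)^{1/2} = a/√π`. [folklore] -/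
private theorem rpow_half_pi_div_pi_div_sq {a : ℝ} (ha : 0 < a) : (π / (π / a) ^ 2) ^ (1 / 2 : ℝ) = a / π ^ (1 / 2 : ℝ) := by
  have hπ := Real.pi_pos
  rw [show π / (π / a) ^ 2 = a ^ 2 / π by field_simp, Real.div_rpow (sq_nonneg a) hπ.le, ← Real.rpow_natCast a 2,
    ← Real.rpow_mul ha.le]
  norm_num

/-! ### §1 The Neumann spectrum of `T_ℓ` and `Z_N = Z_D + θ` -/

section Triangle

variable {ℓ : ℝ}

/-- **THE NEUMANN SPECTRUM OF THE EQUILATERAL TRIANGLE `T_ℓ` AS A FAMILY**: "A complete set of orthogonal Neumann eigenfunctions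
is `T^{s/a}_{m,n}` … where for the symmetric eigenfunctions `T^s_{m,n}` we take `0 ≤ m ≤ n` and cosine, and for the antisymmetric
ones `T^a_{m,n}` we take `0 ≤ m < n` and sine … with the corresponding eigenvalue being `Λ_{m,n}(0) = (4π²/(27r²))(m²+mn+n²)`"
(`r` the inradius, `27r² = 9ℓ²/4`); `{m ≤ n} ⊔ {m < n} ≅ {(m,n) : m,n ≥ 0}` by `(m,n) ↦ (n,m)` on the second piece, the form
being symmetric: the family `(j,k) ↦ (16π²/(9ℓ²))(j² + jk + k²)` on `ℕ × ℕ`. The heat trace converges (`j² + jk + k² ≥ j² + k²`).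
[cite: RudnickWigman2022, §2.1 (verbatim above); BerardHelffer2016, §3 (the torus) and [Ber]] -/
theorem summable_exp_neg_mul_neumannEquilateralTriangle (hℓ : 0 < ℓ) {t : ℝ} (ht : 0 < t) :
    Summable fun p : ℕ × ℕ ↦ Real.exp (-(t * ((4 * π / (3 * ℓ)) ^ 2 * (((p.1 : ℝ)) ^ 2 + (p.1 : ℝ) * (p.2 : ℝ) + ((p.2 : ℝ)) ^ 2)))) := by
  have ha : (0 : ℝ) < 3 * ℓ / 4 := by positivity
  have hR := summable_exp_neg_mul_neumannRectangle ha ha ht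
  rw [pi_div_three_mul_div_four_n hℓ] at hR
  refine Summable.of_nonneg_of_le (fun p ↦ Real.exp_nonneg _) (fun p ↦ ?_) hR
  rw [Real.exp_le_exp]
  have h1 : (0 : ℝ) ≤ (p.1 : ℝ) * (p.2 : ℝ) := by positivity
  have hc : (0 : ℝ) ≤ (4 * π / (3 * ℓ)) ^ 2 := sq_nonneg _
  nlinarith [mul_nonneg hc h1, ht]

/-- **`Z_N = Z_D + θ`**: `{m,n ≥ 0} = {m,n ≥ 1} ⊔ {m ≥ 1, n = 0} ⊔ {m = 0, n ≥ 0}`, the two walls carrying `cm²`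
(`∑_{m≥1}e^{−tcm²} = (θ−1)/2`, `∑_{n≥0}e^{−tcn²} = (θ+1)/2`): `Z_N = Z_D + θ`, `θ = ∑_{a∈ℤ}e^{−tca²}`.
[cite: RudnickWigman2022, §2.1; BerardHelffer2016, Proposition 4.1] -/
theorem tsum_exp_neg_mul_neumannEquilateralTriangle (hℓ : 0 < ℓ) {t : ℝ} (ht : 0 < t) :
    ∑' p : ℕ × ℕ, Real.exp (-(t * ((4 * π / (3 * ℓ)) ^ 2 * (((p.1 : ℝ)) ^ 2 + (p.1 : ℝ) * (p.2 : ℝ) + ((p.2 : ℝ)) ^ 2)))) =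
      (∑' p : ℕ × ℕ, Real.exp (-(t * ((4 * π / (3 * ℓ)) ^ 2 * (((p.1 : ℝ) + 1) ^ 2 + ((p.1 : ℝ) + 1) * ((p.2 : ℝ) + 1) + ((p.2 : ℝ) + 1) ^ 2))))) + ∑' a : ℤ, Real.exp (-(t * ((4 * π / (3 * ℓ)) ^ 2 * ((a : ℝ)) ^ 2))) := by
  have ha : (0 : ℝ) < 3 * ℓ / 4 := by positivity
  have hD := (summable_exp_neg_mul_equilateralTriangle hℓ ht).hasSum
  have hWs := summable_exp_neg_mul_dirichletInterval ha ht
  rw [pi_div_three_mul_div_four_n hℓ] at hWs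
  have hWθ := tsum_exp_neg_mul_dirichletInterval_eq ha ht
  rw [pi_div_three_mul_div_four_n hℓ] at hWθ
  have hVs := summable_exp_neg_mul_neumannInterval ha ht
  rw [pi_div_three_mul_div_four_n hℓ] at hVs
  have hVθ := tsum_exp_neg_mul_neumannInterval_eq ha ht
  rw [pi_div_three_mul_div_four_n hℓ] at hVθ
  -- `{j ≥ 1} × ℕ = {j,k ≥ 1} ⊔ {j ≥ 1, k = 0}`
  have h1 : HasSum (fun q : ℕ × ℕ ↦ Real.exp (-(t * ((4 * π / (3 * ℓ)) ^ 2 * (((((q.1 + 1, q.2) : ℕ × ℕ).1 : ℝ)) ^ 2 + (((q.1 + 1, q.2) : ℕ × ℕ).1 : ℝ) * (((q.1 + 1, q.2) : ℕ × ℕ).2 : ℝ) + ((((q.1 + 1, q.2) : ℕ × ℕ).2 : ℝ)) ^ 2)))))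
      ((∑' p : ℕ × ℕ, Real.exp (-(t * ((4 * π / (3 * ℓ)) ^ 2 * (((p.1 : ℝ) + 1) ^ 2 + ((p.1 : ℝ) + 1) * ((p.2 : ℝ) + 1) + ((p.2 : ℝ) + 1) ^ 2))))) + ∑' n : ℕ, Real.exp (-(t * ((4 * π / (3 * ℓ)) ^ 2 * ((n : ℝ) + 1) ^ 2)))) :=
    hasSum_nat_prod_succ_snd (G := fun q : ℕ × ℕ ↦ Real.exp (-(t * ((4 * π / (3 * ℓ)) ^ 2 * (((((q.1 + 1, q.2) : ℕ × ℕ).1 : ℝ)) ^ 2 + (((q.1 + 1, q.2) : ℕ × ℕ).1 : ℝ) * (((q.1 + 1, q.2) : ℕ × ℕ).2 : ℝ) + ((((q.1 + 1, q.2) : ℕ × ℕ).2 : ℝ)) ^ 2)))))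
      (hD.congr_fun fun q ↦ by dsimp only; congr 1; push_cast; ring)
      (hWs.hasSum.congr_fun fun n ↦ by dsimp only; congr 1; push_cast; ring)
  have h2 := hasSum_nat_prod_succ_fst (G := fun p : ℕ × ℕ ↦ Real.exp (-(t * ((4 * π / (3 * ℓ)) ^ 2 * (((p.1 : ℝ)) ^ 2 + (p.1 : ℝ) * (p.2 : ℝ) + ((p.2 : ℝ)) ^ 2))))) h1
    (hVs.hasSum.congr_fun fun n ↦ by dsimp only; congr 1; push_cast; ring)
  rw [h2.tsum_eq, hWθ, hVθ]
  ring

/-- **THE NEUMANN EQUILATERAL TRIANGLE TO ALL ORDERS: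
`Z_N(t) − ((√3/4)ℓ²/(4π)·t^{−1} + 3ℓ/(8√π)·t^{−1/2} + 1/3) = O(t^β)` for EVERY `β`** — `Z_D`'s expansion (row g39-#10) plus
`θ = (π/c)^{1/2}t^{−1/2} + O(t^∞) = (3ℓ/(4√π))t^{−1/2} + O(t^∞)`: the perimeter term flips sign, Kac's corner term `1/3` is
unchanged. [cite: McKeanSinger1967, eq. (4a) and eq. (6) (the sign `±` of the boundary term for `Δ±`); RudnickWigman2022, §2.1] -/
theorem isBigO_neumannEquilateralTriangle_heatTrace_sub (hℓ : 0 < ℓ) (β : ℝ) :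
    (fun t : ℝ ↦ ∑' p : ℕ × ℕ, Real.exp (-(t * ((4 * π / (3 * ℓ)) ^ 2 * (((p.1 : ℝ)) ^ 2 + (p.1 : ℝ) * (p.2 : ℝ) + ((p.2 : ℝ)) ^ 2)))) -
      (Real.sqrt 3 * ℓ ^ 2 / (16 * π) * t ^ (-1 : ℝ) + 3 * ℓ / (8 * π ^ (1 / 2 : ℝ)) * t ^ (-(1 / 2 : ℝ)) + 1 / 3))
      =O[𝓝[>] 0] fun t : ℝ ↦ t ^ β := by
  have ha : (0 : ℝ) < 3 * ℓ / 4 := by positivity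
  have hc : (0 : ℝ) < (4 * π / (3 * ℓ)) ^ 2 := by positivity
  have hD := isBigO_equilateralTriangle_heatTrace_sub hℓ β
  have hθ := isBigO_tsum_exp_neg_mul_mul_intCast_sq_sub hc β
  have e2 : (π / (4 * π / (3 * ℓ)) ^ 2) ^ (1 / 2 : ℝ) = 3 * ℓ / 4 / π ^ (1 / 2 : ℝ) := by
    rw [← pi_div_three_mul_div_four_n hℓ, rpow_half_pi_div_pi_div_sq ha]
  refine (hD.add hθ).congr' ?_ EventuallyEq.rfl
  filter_upwards [self_mem_nhdsWithin] with t (ht : 0 < t)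
  rw [tsum_exp_neg_mul_neumannEquilateralTriangle hℓ ht, e2]
  ring

/-- The expansion in the format of the abstract theory: `κ = Fin 3`, `a = ((√3/4)ℓ²/(4π), +3ℓ/(8√π), 1/3)`, `α = (−1, −½, 0)`.
[cite: McKeanSinger1967, eq. (4a), (6); Gilkey1995, §1.10 Lemma 1.10.1] -/
theorem isBigO_neumannEquilateralTriangle_heatTrace_expansion (hℓ : 0 < ℓ) (β : ℝ) :
    (fun t : ℝ ↦ ∑' p : ℕ × ℕ, Real.exp (-(t * ((4 * π / (3 * ℓ)) ^ 2 * (((p.1 : ℝ)) ^ 2 + (p.1 : ℝ) * (p.2 : ℝ) + ((p.2 : ℝ)) ^ 2)))) -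
      ∑ k : Fin 3, (![Real.sqrt 3 * ℓ ^ 2 / (16 * π), 3 * ℓ / (8 * π ^ (1 / 2 : ℝ)), 1 / 3] : Fin 3 → ℝ) k *
        t ^ ((![(-1 : ℝ), -(1 / 2 : ℝ), 0] : Fin 3 → ℝ) k)) =O[𝓝[>] 0] fun t : ℝ ↦ t ^ β := by
  refine (isBigO_neumannEquilateralTriangle_heatTrace_sub hℓ β).congr' ?_ EventuallyEq.rfl
  filter_upwards [self_mem_nhdsWithin] with t (ht : 0 < t)
  simp only [Fin.sum_univ_three, Matrix.cons_val_zero, Matrix.cons_val_one, Matrix.cons_val, Real.rpow_zero, mul_one]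

/-- The Neumann spectrum of `T_ℓ` is discrete. [cite: RudnickWigman2022, §2.1] -/
theorem tendsto_neumannEquilateralTriangle_cofinite_atTop (hℓ : 0 < ℓ) :
    Tendsto (fun p : ℕ × ℕ ↦ (4 * π / (3 * ℓ)) ^ 2 * (((p.1 : ℝ)) ^ 2 + (p.1 : ℝ) * (p.2 : ℝ) + ((p.2 : ℝ)) ^ 2)) cofinite atTop := by
  have ha : (0 : ℝ) < 3 * ℓ / 4 := by positivity
  have hR := tendsto_add_cofinite_atTop (tendsto_neumannInterval_cofinite_atTop ha) (tendsto_neumannInterval_cofinite_atTop ha)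
  rw [pi_div_three_mul_div_four_n hℓ] at hR
  refine tendsto_atTop_mono (fun p ↦ ?_) hR
  have h1 : (0 : ℝ) ≤ (p.1 : ℝ) * (p.2 : ℝ) := by positivity
  have hc : (0 : ℝ) ≤ (4 * π / (3 * ℓ)) ^ 2 := sq_nonneg _
  nlinarith [mul_nonneg hc h1]

/-- **ONE zero mode** (the constants: `m = n = 0`). [cite: RudnickWigman2022, §2.1] -/
theorem ncard_setOf_neumannEquilateralTriangle_eq_zero (hℓ : 0 < ℓ) :
    {p : ℕ × ℕ | (4 * π / (3 * ℓ)) ^ 2 * (((p.1 : ℝ)) ^ 2 + (p.1 : ℝ) * (p.2 : ℝ) + ((p.2 : ℝ)) ^ 2) = 0}.ncard = 1 := by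
  have hc : (0 : ℝ) < (4 * π / (3 * ℓ)) ^ 2 := by positivity
  have h : {p : ℕ × ℕ | (4 * π / (3 * ℓ)) ^ 2 * (((p.1 : ℝ)) ^ 2 + (p.1 : ℝ) * (p.2 : ℝ) + ((p.2 : ℝ)) ^ 2) = 0} = {((0 : ℕ), (0 : ℕ))} := by
    ext ⟨j, k⟩
    simp only [Set.mem_setOf_eq, Set.mem_singleton_iff, Prod.mk.injEq, mul_eq_zero, hc.ne', false_or]
    constructor
    · intro h
      have hj : (0 : ℝ) ≤ j := j.cast_nonneg
      have hk : (0 : ℝ) ≤ k := k.cast_nonneg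
      have hj0 : (j : ℝ) = 0 := by nlinarith [mul_nonneg hj hk, sq_nonneg (j : ℝ), sq_nonneg (k : ℝ)]
      have hk0 : (k : ℝ) = 0 := by nlinarith [mul_nonneg hj hk, sq_nonneg (j : ℝ), sq_nonneg (k : ℝ)]
      exact ⟨by exact_mod_cast hj0, by exact_mod_cast hk0⟩
    · rintro ⟨rfl, rfl⟩
      simp
  rw [h, Set.ncard_singleton]

/-! ### §2 Consequences: Weyl, `Γζ_N`, `ζ_N(0) = 1/3 − 1 = −2/3` -/

/-- **WEYL'S LAW FOR THE NEUMANN EQUILATERAL TRIANGLE: `#{λ ≤ Λ}/Λ → (√3/4)ℓ²/(4π)`.** [cite: McKeanSinger1967, p. 43; Berard1986,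
Ch. VII nº10 (ii), nº15 (16)] -/
theorem tendsto_ncard_neumannEquilateralTriangle_le_div (hℓ : 0 < ℓ) :
    Tendsto (fun l : ℝ ↦ (({p : ℕ × ℕ | (4 * π / (3 * ℓ)) ^ 2 * (((p.1 : ℝ)) ^ 2 + (p.1 : ℝ) * (p.2 : ℝ) + ((p.2 : ℝ)) ^ 2) ≤ l}.ncard : ℕ) : ℝ) / l) atTop
      (𝓝 (Real.sqrt 3 * ℓ ^ 2 / (16 * π))) := by
  have hexp : (fun t : ℝ ↦ ∑' p : ℕ × ℕ, Real.exp (-(((4 * π / (3 * ℓ)) ^ 2 * (((p.1 : ℝ)) ^ 2 + (p.1 : ℝ) * (p.2 : ℝ) + ((p.2 : ℝ)) ^ 2)) * t)) -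
      ∑ k : Fin 3, (![Real.sqrt 3 * ℓ ^ 2 / (16 * π), 3 * ℓ / (8 * π ^ (1 / 2 : ℝ)), 1 / 3] : Fin 3 → ℝ) k *
        t ^ ((![(-1 : ℝ), -(1 / 2 : ℝ), 0] : Fin 3 → ℝ) k)) =O[𝓝[>] 0] fun t : ℝ ↦ t ^ (0 : ℝ) := by
    refine (isBigO_neumannEquilateralTriangle_heatTrace_expansion hℓ 0).congr' ?_ EventuallyEq.rfl
    filter_upwards with t
    congr 1
    exact tsum_congr fun p ↦ by rw [mul_comm]
  have hsum : ∀ t : ℝ, 0 < t → Summable fun p : ℕ × ℕ ↦ Real.exp (-(((4 * π / (3 * ℓ)) ^ 2 * (((p.1 : ℝ)) ^ 2 + (p.1 : ℝ) * (p.2 : ℝ) + ((p.2 : ℝ)) ^ 2)) * t)) :=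
    fun t ht ↦ (summable_exp_neg_mul_neumannEquilateralTriangle hℓ ht).congr fun p ↦ by rw [mul_comm]
  have h := tendsto_ncard_le_div_rpow_of_expansion (μ := fun p : ℕ × ℕ ↦ (4 * π / (3 * ℓ)) ^ 2 * (((p.1 : ℝ)) ^ 2 + (p.1 : ℝ) * (p.2 : ℝ) + ((p.2 : ℝ)) ^ 2)) (ρ := 1)
    (fun p ↦ by positivity) hsum hexp (fun k ↦ by fin_cases k <;> norm_num) (by norm_num) (by norm_num)
  have e : (∑ k : Fin 3, if (![(-1 : ℝ), -(1 / 2 : ℝ), 0] : Fin 3 → ℝ) k = -1 then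
      (![Real.sqrt 3 * ℓ ^ 2 / (16 * π), 3 * ℓ / (8 * π ^ (1 / 2 : ℝ)), 1 / 3] : Fin 3 → ℝ) k else 0) / Real.Gamma (1 + 1) =
      Real.sqrt 3 * ℓ ^ 2 / (16 * π) := by
    rw [Fin.sum_univ_three]
    simp only [Matrix.cons_val_zero, Matrix.cons_val_one, Matrix.cons_val, if_true,
      show ¬(-(1 / 2 : ℝ) = -1) by norm_num, show ¬((0 : ℝ) = -1) by norm_num, if_false, add_zero,
      show (1 : ℝ) + 1 = 2 by norm_num, Real.Gamma_two, div_one]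
  rw [e] at h
  refine h.congr' ?_
  filter_upwards with l
  rw [Real.rpow_one]

/-- **GILKEY'S LEMMA 1.10.1 FOR THE NEUMANN EQUILATERAL TRIANGLE: `Γ(s)·ζ_N(s) = ∑ₖ aₖ/(s + αₖ) − 1/s + r(s)`** on `Re s > 1`,
`(aₖ) = ((√3/4)ℓ²/(4π), 3ℓ/(8√π), 1/3)`, `(αₖ) = (−1, −½, 0)`, the `−1/s` from the zero mode.
[cite: Gilkey1995, §1.10 Lemma 1.10.1; McKeanSinger1967, eq. (4a)] -/
theorem Gamma_mul_tsum_neumannEquilateralTriangle_cpow_neg_eq (hℓ : 0 < ℓ) {s : ℂ} (hs : 1 < s.re) :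
    Complex.Gamma s * ∑' p : {p : ℕ × ℕ | (4 * π / (3 * ℓ)) ^ 2 * (((p.1 : ℝ)) ^ 2 + (p.1 : ℝ) * (p.2 : ℝ) + ((p.2 : ℝ)) ^ 2) ≠ 0},
        ((((4 * π / (3 * ℓ)) ^ 2 * ((((p : ℕ × ℕ).1 : ℝ)) ^ 2 + ((p : ℕ × ℕ).1 : ℝ) * ((p : ℕ × ℕ).2 : ℝ) + (((p : ℕ × ℕ).2 : ℝ)) ^ 2)) : ℝ) : ℂ) ^ (-s) =
      (∑ k : Fin 3, ((![Real.sqrt 3 * ℓ ^ 2 / (16 * π), 3 * ℓ / (8 * π ^ (1 / 2 : ℝ)), 1 / 3] : Fin 3 → ℝ) k : ℂ) /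
            (s + ((![(-1 : ℝ), -(1 / 2 : ℝ), 0] : Fin 3 → ℝ) k : ℝ)) -
          ({p : ℕ × ℕ | (4 * π / (3 * ℓ)) ^ 2 * (((p.1 : ℝ)) ^ 2 + (p.1 : ℝ) * (p.2 : ℝ) + ((p.2 : ℝ)) ^ 2) = 0}.ncard : ℂ) / s +
        mellin (fun t : ℝ ↦ ((∑' p : {p : ℕ × ℕ | (4 * π / (3 * ℓ)) ^ 2 * (((p.1 : ℝ)) ^ 2 + (p.1 : ℝ) * (p.2 : ℝ) + ((p.2 : ℝ)) ^ 2) ≠ 0},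
            Real.exp (-(t * ((4 * π / (3 * ℓ)) ^ 2 * ((((p : ℕ × ℕ).1 : ℝ)) ^ 2 + ((p : ℕ × ℕ).1 : ℝ) * ((p : ℕ × ℕ).2 : ℝ) + (((p : ℕ × ℕ).2 : ℝ)) ^ 2)))) : ℝ) : ℂ) -
          (Ioc 0 1).indicator (fun t : ℝ ↦ ((∑ k : Fin 3, (![Real.sqrt 3 * ℓ ^ 2 / (16 * π), 3 * ℓ / (8 * π ^ (1 / 2 : ℝ)), 1 / 3] : Fin 3 → ℝ) k *
              t ^ ((![(-1 : ℝ), -(1 / 2 : ℝ), 0] : Fin 3 → ℝ) k) : ℝ) : ℂ) -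
            ({p : ℕ × ℕ | (4 * π / (3 * ℓ)) ^ 2 * (((p.1 : ℝ)) ^ 2 + (p.1 : ℝ) * (p.2 : ℝ) + ((p.2 : ℝ)) ^ 2) = 0}.ncard : ℂ)) t) s) := by
  have h := Gamma_mul_tsum_cpow_neg_eq_of_expansion (μ := fun p : ℕ × ℕ ↦ (4 * π / (3 * ℓ)) ^ 2 * (((p.1 : ℝ)) ^ 2 + (p.1 : ℝ) * (p.2 : ℝ) + ((p.2 : ℝ)) ^ 2))
    (a := ![Real.sqrt 3 * ℓ ^ 2 / (16 * π), 3 * ℓ / (8 * π ^ (1 / 2 : ℝ)), 1 / 3]) (α := ![(-1 : ℝ), -(1 / 2 : ℝ), 0])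
    (β := 1) (σ := 1) (fun p ↦ by positivity) (tendsto_neumannEquilateralTriangle_cofinite_atTop hℓ)
    (fun t ht ↦ summable_exp_neg_mul_neumannEquilateralTriangle hℓ ht)
    (isBigO_neumannEquilateralTriangle_heatTrace_expansion hℓ 1) (by norm_num) (by norm_num)
    (fun k ↦ by fin_cases k <;> norm_num) hs
  exact h

/-- **`ζ_N(0) = 1/3 − 1 = −2/3` FOR THE NEUMANN EQUILATERAL TRIANGLE** (corner term minus the one zero mode).
[cite: Gilkey1995, §1.10 Lemma 1.10.1; McKeanSinger1967, eq. (4a)] -/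
theorem tendsto_neumannEquilateralTriangleZeta_continuation_nhdsNE_zero (hℓ : 0 < ℓ) :
    Tendsto (fun s : ℂ ↦ (Complex.Gamma s)⁻¹ *
        (∑ k : Fin 3, ((![Real.sqrt 3 * ℓ ^ 2 / (16 * π), 3 * ℓ / (8 * π ^ (1 / 2 : ℝ)), 1 / 3] : Fin 3 → ℝ) k : ℂ) /
            (s + ((![(-1 : ℝ), -(1 / 2 : ℝ), 0] : Fin 3 → ℝ) k : ℝ)) -
          ({p : ℕ × ℕ | (4 * π / (3 * ℓ)) ^ 2 * (((p.1 : ℝ)) ^ 2 + (p.1 : ℝ) * (p.2 : ℝ) + ((p.2 : ℝ)) ^ 2) = 0}.ncard : ℂ) / s +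
        mellin (fun t : ℝ ↦ ((∑' p : {p : ℕ × ℕ | (4 * π / (3 * ℓ)) ^ 2 * (((p.1 : ℝ)) ^ 2 + (p.1 : ℝ) * (p.2 : ℝ) + ((p.2 : ℝ)) ^ 2) ≠ 0},
            Real.exp (-(t * ((4 * π / (3 * ℓ)) ^ 2 * ((((p : ℕ × ℕ).1 : ℝ)) ^ 2 + ((p : ℕ × ℕ).1 : ℝ) * ((p : ℕ × ℕ).2 : ℝ) + (((p : ℕ × ℕ).2 : ℝ)) ^ 2)))) : ℝ) : ℂ) -
          (Ioc 0 1).indicator (fun t : ℝ ↦ ((∑ k : Fin 3, (![Real.sqrt 3 * ℓ ^ 2 / (16 * π), 3 * ℓ / (8 * π ^ (1 / 2 : ℝ)), 1 / 3] : Fin 3 → ℝ) k *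
              t ^ ((![(-1 : ℝ), -(1 / 2 : ℝ), 0] : Fin 3 → ℝ) k) : ℝ) : ℂ) -
            ({p : ℕ × ℕ | (4 * π / (3 * ℓ)) ^ 2 * (((p.1 : ℝ)) ^ 2 + (p.1 : ℝ) * (p.2 : ℝ) + ((p.2 : ℝ)) ^ 2) = 0}.ncard : ℂ)) t) s))
      (𝓝[≠] 0) (𝓝 (-(2 / 3))) := by
  have h := tendsto_continuation_nhdsNE_zero (μ := fun p : ℕ × ℕ ↦ (4 * π / (3 * ℓ)) ^ 2 * (((p.1 : ℝ)) ^ 2 + (p.1 : ℝ) * (p.2 : ℝ) + ((p.2 : ℝ)) ^ 2))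
    (a := ![Real.sqrt 3 * ℓ ^ 2 / (16 * π), 3 * ℓ / (8 * π ^ (1 / 2 : ℝ)), 1 / 3]) (α := ![(-1 : ℝ), -(1 / 2 : ℝ), 0])
    (β := 1) (fun p ↦ by positivity) (tendsto_neumannEquilateralTriangle_cofinite_atTop hℓ)
    (fun t ht ↦ summable_exp_neg_mul_neumannEquilateralTriangle hℓ ht)
    (isBigO_neumannEquilateralTriangle_heatTrace_expansion hℓ 1) one_pos
  have e : ((∑ k : Fin 3, if (![(-1 : ℝ), -(1 / 2 : ℝ), 0] : Fin 3 → ℝ) k = 0 then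
      ((![Real.sqrt 3 * ℓ ^ 2 / (16 * π), 3 * ℓ / (8 * π ^ (1 / 2 : ℝ)), 1 / 3] : Fin 3 → ℝ) k : ℂ) else 0) -
      ({p : ℕ × ℕ | (4 * π / (3 * ℓ)) ^ 2 * (((p.1 : ℝ)) ^ 2 + (p.1 : ℝ) * (p.2 : ℝ) + ((p.2 : ℝ)) ^ 2) = 0}.ncard : ℂ)) = -(2 / 3) := by
    rw [ncard_setOf_neumannEquilateralTriangle_eq_zero hℓ, Fin.sum_univ_three]
    simp only [Matrix.cons_val_zero, Matrix.cons_val_one, Matrix.cons_val,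
      show ¬((-1 : ℝ) = 0) by norm_num, show ¬(-(1 / 2 : ℝ) = 0) by norm_num, if_false, if_true, zero_add,
      Nat.cast_one]
    push_cast
    ring
  rw [e] at h
  exact h

/-- **Residue `(√3/4)ℓ²/(4π)` of `ζ_N` at `s = 1`.** [cite: Gilkey1995, §1.10 Lemma 1.10.1] -/
theorem tendsto_sub_one_mul_neumannEquilateralTriangleZeta_continuation (hℓ : 0 < ℓ) :
    Tendsto (fun s : ℂ ↦ (s - (1 : ℝ)) * ((Complex.Gamma s)⁻¹ *
        (∑ k : Fin 3, ((![Real.sqrt 3 * ℓ ^ 2 / (16 * π), 3 * ℓ / (8 * π ^ (1 / 2 : ℝ)), 1 / 3] : Fin 3 → ℝ) k : ℂ) /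
            (s + ((![(-1 : ℝ), -(1 / 2 : ℝ), 0] : Fin 3 → ℝ) k : ℝ)) -
          ({p : ℕ × ℕ | (4 * π / (3 * ℓ)) ^ 2 * (((p.1 : ℝ)) ^ 2 + (p.1 : ℝ) * (p.2 : ℝ) + ((p.2 : ℝ)) ^ 2) = 0}.ncard : ℂ) / s +
        mellin (fun t : ℝ ↦ ((∑' p : {p : ℕ × ℕ | (4 * π / (3 * ℓ)) ^ 2 * (((p.1 : ℝ)) ^ 2 + (p.1 : ℝ) * (p.2 : ℝ) + ((p.2 : ℝ)) ^ 2) ≠ 0},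
            Real.exp (-(t * ((4 * π / (3 * ℓ)) ^ 2 * ((((p : ℕ × ℕ).1 : ℝ)) ^ 2 + ((p : ℕ × ℕ).1 : ℝ) * ((p : ℕ × ℕ).2 : ℝ) + (((p : ℕ × ℕ).2 : ℝ)) ^ 2)))) : ℝ) : ℂ) -
          (Ioc 0 1).indicator (fun t : ℝ ↦ ((∑ k : Fin 3, (![Real.sqrt 3 * ℓ ^ 2 / (16 * π), 3 * ℓ / (8 * π ^ (1 / 2 : ℝ)), 1 / 3] : Fin 3 → ℝ) k *
              t ^ ((![(-1 : ℝ), -(1 / 2 : ℝ), 0] : Fin 3 → ℝ) k) : ℝ) : ℂ) -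
            ({p : ℕ × ℕ | (4 * π / (3 * ℓ)) ^ 2 * (((p.1 : ℝ)) ^ 2 + (p.1 : ℝ) * (p.2 : ℝ) + ((p.2 : ℝ)) ^ 2) = 0}.ncard : ℂ)) t) s)))
      (𝓝[≠] ((1 : ℝ) : ℂ)) (𝓝 ((Real.sqrt 3 * ℓ ^ 2 / (16 * π) : ℝ) : ℂ)) := by
  have h := tendsto_sub_mul_continuation_nhdsNE (μ := fun p : ℕ × ℕ ↦ (4 * π / (3 * ℓ)) ^ 2 * (((p.1 : ℝ)) ^ 2 + (p.1 : ℝ) * (p.2 : ℝ) + ((p.2 : ℝ)) ^ 2))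
    (a := ![Real.sqrt 3 * ℓ ^ 2 / (16 * π), 3 * ℓ / (8 * π ^ (1 / 2 : ℝ)), 1 / 3]) (α := ![(-1 : ℝ), -(1 / 2 : ℝ), 0])
    (β := 1) (fun p ↦ by positivity) (tendsto_neumannEquilateralTriangle_cofinite_atTop hℓ)
    (fun t ht ↦ summable_exp_neg_mul_neumannEquilateralTriangle hℓ ht)
    (isBigO_neumannEquilateralTriangle_heatTrace_expansion hℓ 1) (s₀ := 1) (by norm_num)
  have e : (Complex.Gamma ((1 : ℝ) : ℂ))⁻¹ *
      ((∑ k : Fin 3, if (![(-1 : ℝ), -(1 / 2 : ℝ), 0] : Fin 3 → ℝ) k = -(1 : ℝ) then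
        ((![Real.sqrt 3 * ℓ ^ 2 / (16 * π), 3 * ℓ / (8 * π ^ (1 / 2 : ℝ)), 1 / 3] : Fin 3 → ℝ) k : ℂ) else 0) -
        if (1 : ℝ) = 0 then ({p : ℕ × ℕ | (4 * π / (3 * ℓ)) ^ 2 * (((p.1 : ℝ)) ^ 2 + (p.1 : ℝ) * (p.2 : ℝ) + ((p.2 : ℝ)) ^ 2) = 0}.ncard : ℂ) else 0) =
      ((Real.sqrt 3 * ℓ ^ 2 / (16 * π) : ℝ) : ℂ) := by
    rw [Fin.sum_univ_three]
    simp only [Matrix.cons_val_zero, Matrix.cons_val_one, Matrix.cons_val, if_true,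
      show ¬(-(1 / 2 : ℝ) = -1) by norm_num, show ¬((0 : ℝ) = -1) by norm_num, if_false, add_zero, one_ne_zero,
      sub_zero, Complex.ofReal_one, Complex.Gamma_one, inv_one, one_mul]
  rw [e] at h
  exact h

end Triangle

/-! ### §3 Audible: Neumann versus Dirichlet on `T_ℓ`, and the Neumann triangle versus Neumann rectangles -/

section HearTheShape

variable {ℓ p q : ℝ}

/-- **`Z_N − Z_D = θ = (3ℓ/(4√π))t^{−1/2} + O(t^∞)` on `T_ℓ`** (the two walls and the origin of the weight lattice).
[cite: McKeanSinger1967, eq. (6) (`Z⁺ − Z⁻`); RudnickWigman2022, §2.1] -/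
theorem isBigO_neumann_sub_dirichlet_equilateralTriangle (hℓ : 0 < ℓ) (β : ℝ) :
    (fun t : ℝ ↦ (∑' r : ℕ × ℕ, Real.exp (-(t * ((4 * π / (3 * ℓ)) ^ 2 * (((r.1 : ℝ)) ^ 2 + (r.1 : ℝ) * (r.2 : ℝ) + ((r.2 : ℝ)) ^ 2))))) - (∑' r : ℕ × ℕ, Real.exp (-(t * ((4 * π / (3 * ℓ)) ^ 2 * (((r.1 : ℝ) + 1) ^ 2 + ((r.1 : ℝ) + 1) * ((r.2 : ℝ) + 1) + ((r.2 : ℝ) + 1) ^ 2))))) -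
      3 * ℓ / (4 * π ^ (1 / 2 : ℝ)) * t ^ (-(1 / 2 : ℝ))) =O[𝓝[>] 0] fun t : ℝ ↦ t ^ β := by
  refine ((isBigO_neumannEquilateralTriangle_heatTrace_sub hℓ β).sub (isBigO_equilateralTriangle_heatTrace_sub hℓ β)).congr' ?_
    EventuallyEq.rfl
  filter_upwards with t
  ring

/-- **The Neumann and the Dirichlet equilateral triangle are not isospectral** (the `t^{−1/2}` coefficients `±3ℓ/(8√π)` differ).
[cite: McKeanSinger1967, eq. (6); Berard1986, Ch. VII nº4–nº6] -/
theorem not_isospectral_neumann_dirichlet_equilateralTriangle (hℓ : 0 < ℓ) :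
    ¬ ∀ x : ℝ, {r : ℕ × ℕ | (4 * π / (3 * ℓ)) ^ 2 * (((r.1 : ℝ)) ^ 2 + (r.1 : ℝ) * (r.2 : ℝ) + ((r.2 : ℝ)) ^ 2) = x}.ncard = {r : ℕ × ℕ | (4 * π / (3 * ℓ)) ^ 2 * (((r.1 : ℝ) + 1) ^ 2 + ((r.1 : ℝ) + 1) * ((r.2 : ℝ) + 1) + ((r.2 : ℝ) + 1) ^ 2) = x}.ncard := by
  intro hN
  have h := heatCoeff_eq_of_ncard_eq (μ := fun r : ℕ × ℕ ↦ (4 * π / (3 * ℓ)) ^ 2 * (((r.1 : ℝ)) ^ 2 + (r.1 : ℝ) * (r.2 : ℝ) + ((r.2 : ℝ)) ^ 2)) (ν := fun r : ℕ × ℕ ↦ (4 * π / (3 * ℓ)) ^ 2 * (((r.1 : ℝ) + 1) ^ 2 + ((r.1 : ℝ) + 1) * ((r.2 : ℝ) + 1) + ((r.2 : ℝ) + 1) ^ 2))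
    (α := ![(-1 : ℝ), -(1 / 2 : ℝ), 0]) (β := 1)
    (tendsto_neumannEquilateralTriangle_cofinite_atTop hℓ) (tendsto_equilateralTriangle_cofinite_atTop hℓ) hN
    (fun i j hij ↦ by fin_cases i <;> fin_cases j <;> norm_num at hij <;> rfl)
    (fun k ↦ by fin_cases k <;> norm_num)
    (isBigO_neumannEquilateralTriangle_heatTrace_expansion hℓ 1) (isBigO_equilateralTriangle_heatTrace_expansion hℓ 1)
  have hπ2 : 0 < π ^ (1 / 2 : ℝ) := Real.rpow_pos_of_pos Real.pi_pos _
  have h1 := congrFun h 1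
  simp only [Matrix.cons_val_one, Matrix.cons_val_zero] at h1
  have : 0 < 3 * ℓ / (8 * π ^ (1 / 2 : ℝ)) := by positivity
  linarith

/-- **A NEUMANN EQUILATERAL TRIANGLE IS NEVER ISOSPECTRAL TO A NEUMANN RECTANGLE** (corner terms `1/3 ≠ ¼`, row g38-#2).
[cite: McKeanSinger1967, eq. (4a); Kac1966, §14] -/
theorem not_isospectral_neumannEquilateralTriangle_neumannRectangle (hℓ : 0 < ℓ) (hp : 0 < p) (hq : 0 < q) :
    ¬ ∀ x : ℝ, {r : ℕ × ℕ | (4 * π / (3 * ℓ)) ^ 2 * (((r.1 : ℝ)) ^ 2 + (r.1 : ℝ) * (r.2 : ℝ) + ((r.2 : ℝ)) ^ 2) = x}.ncard =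
      {r : ℕ × ℕ | (π / p) ^ 2 * ((r.1 : ℝ)) ^ 2 + (π / q) ^ 2 * ((r.2 : ℝ)) ^ 2 = x}.ncard := by
  intro hN
  have hR : Tendsto (fun r : ℕ × ℕ ↦ (π / p) ^ 2 * ((r.1 : ℝ)) ^ 2 + (π / q) ^ 2 * ((r.2 : ℝ)) ^ 2) cofinite atTop :=
    tendsto_add_cofinite_atTop (tendsto_neumannInterval_cofinite_atTop hp) (tendsto_neumannInterval_cofinite_atTop hq)
  have h := heatCoeff_eq_of_ncard_eq (μ := fun r : ℕ × ℕ ↦ (4 * π / (3 * ℓ)) ^ 2 * (((r.1 : ℝ)) ^ 2 + (r.1 : ℝ) * (r.2 : ℝ) + ((r.2 : ℝ)) ^ 2))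
    (ν := fun r : ℕ × ℕ ↦ (π / p) ^ 2 * ((r.1 : ℝ)) ^ 2 + (π / q) ^ 2 * ((r.2 : ℝ)) ^ 2)
    (α := ![(-1 : ℝ), -(1 / 2 : ℝ), 0]) (β := 1)
    (tendsto_neumannEquilateralTriangle_cofinite_atTop hℓ) hR hN
    (fun i j hij ↦ by fin_cases i <;> fin_cases j <;> norm_num at hij <;> rfl)
    (fun k ↦ by fin_cases k <;> norm_num)
    (isBigO_neumannEquilateralTriangle_heatTrace_expansion hℓ 1) (isBigO_neumannRectangle_heatTrace_expansion hp hq 1)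
  have h2 := congrFun h 2
  simp only [Matrix.cons_val] at h2
  norm_num at h2

end HearTheShape

end Literature.Analysis.InnerProduct
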